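import Literature.MathematicalPhysics.StatisticalMechanics.HardSphereGibbs
import Mathlib.MeasureTheory.Measure.Haar.InnerProductSpace
import Mathlib.MeasureTheory.Measure.Lebesgue.Basic
import HarnessLib

/-!
# The hard-sphere specification is a proper family of probability kernels; DLR states live on
# hard-core configurations

Topic `Literature/MathematicalPhysics/StatisticalMechanics`; PROOFS (no new definitions, no named
facts) about the objects of `HardSphereGibbs.lean` (definition item
`defn-HardSphereSpecificRelEntropy`: `HardSphere.gibbsSpec`, `HardSphere.IsGibbs`), supplying the
properties every use of a DLR specification `γ_Λ(· | η)` takes for granted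
(Georgii 2011, Def. 1.23 (i)–(ii): "each `γ_Λ(· | ω)` is a probability measure" and
"`γ_Λ(A | ·)` is measurable"; Richthammer 2007, §3.3 for the hard-core point process: "`γ_Λ` is a
probability kernel from `(𝒳𝒳, 𝓕_{Λᶜ})` to `(𝒳, 𝓕)`" and (3.2) "a Gibbs measure is concentrated
on hard-core configurations"):

* `HardSphere.isProbabilityMeasure_gibbsSpec` — for a bounded Borel region `Λ` and every boundary
  condition `η` that satisfies the hard core OUTSIDE `Λ`, `gibbsSpec p Λ η` is a probability
  measure: the partition function `Ξ_Λ(η) = P(glued Poisson sample is hard core)` is at least the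
  void probability `e^{-z⁺ λ(Λ)} > 0` of the Poisson–Maxwell reference ("positivity of the
  partition function by considering the empty configuration") and at most `1`;
* `HardSphere.gibbsSpec_map_restrict_compl` — PROPERNESS: under `γ_Λ(· | η)` the configuration
  outside `Λ` is `η|_{Λᶜ}` (its law is the point mass, Georgii Def. 1.23 (ii));
* `HardSphere.measurable_gibbsSpec_apply` — `η ↦ γ_Λ(A | η)` is measurable for measurable `Λ`,
  `A` (joint measurability of gluing, `measurable_glue_uncurry`, and the measurability part of
  Fubini);
* `HardSphere.IsGibbs.measure_compl_hardCoreSet`, `HardSphere.IsGibbs.ae_isHardCore` — every DLR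
  state gives full measure to hard-core configurations (the DLR equation in the EMPTY region
  already forces it, since every `γ_Λ(· | η)` is supported on the hard-core event); hence
  `IsGibbs.ae_isProbabilityMeasure_gibbsSpec`. Also `gibbsSpec_univ_le_one` (always a
  sub-probability measure);
* the cubes `HardSphere.cube L = [-L, L]³` of `HardSphere.specificRelEntropy` are Borel and bounded
  with `volume_cube : λ(Λ_L) = (2L)³` (so the normalisation `|Λ_L|⁻¹` is finite and nonzero), and
  the DLR equation / free-boundary kernels specialise to them
  (`IsGibbs.lintegral_gibbsSpec_cube`, `isProbabilityMeasure_gibbsSpec_cube_empty`).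

## References

* H.-O. Georgii, *Gibbs Measures and Phase Transitions*, 2nd ed. (de Gruyter 2011), Def. 1.23.
* T. Richthammer, *Translation-invariance of two-dimensional Gibbsian point processes*, Comm.
  Math. Phys. 274 (2007) 81–122, §3.3 (p. 7), (3.1)–(3.2).
* D. Ruelle, *Statistical Mechanics: Rigorous Results* (1969), §1.2.1–1.2.2.
-/

noncomputable section

open MeasureTheory ProbabilityTheory Set Filter
open scoped ENNReal NNReal

namespace Literature.MathematicalPhysics.StatisticalMechanics.HardSphere

open Literature.Analysis.FunctionSpaces

/-! ### Gluing: membership, the void event, joint measurability -/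

/-- Membership in a glued configuration: the inner configuration inside the window of `Λ`, the
boundary condition outside. [folklore] -/
theorem mem_glue_iff {Λ : Set Pos} {η ξ : PointConfig Phase} {x : Phase} :
    x ∈ glue Λ η ξ ↔ (x ∈ ξ ∧ x.1 ∈ Λ) ∨ (x ∈ η ∧ x.1 ∉ Λ) := by
  change (x ∈ ξ.carrier ∩ window Λ ∨ x ∈ η.carrier ∩ (window Λ)ᶜ) ↔ _
  simp [mem_window]

/-- On the void event `N(Λ × ℝ³) = 0` of the inner configuration, gluing returns the boundary
condition restricted to the outside of `Λ` (the "empty configuration" term of the partition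
function). [cite: Richthammer2007, §3.3 (p. 7)] -/
theorem glue_eq_restrict_of_count_eq_zero {Λ : Set Pos} {η ξ : PointConfig Phase}
    (h : ξ.count (window Λ) = 0) : glue Λ η ξ = η.restrict (window Λ)ᶜ := by
  have hempty : ξ.carrier ∩ window Λ = ∅ := by
    rwa [PointConfig.count, Set.encard_eq_zero] at h
  ext x
  rw [mem_glue_iff]
  change _ ↔ x ∈ η.carrier ∩ (window Λ)ᶜ
  simp only [mem_inter_iff, mem_compl_iff, mem_window, PointConfig.mem_carrier]
  constructor
  · rintro (⟨hx, hΛ⟩ | ⟨hx, hΛ⟩)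
    · have hx' : x ∈ ξ.carrier ∩ window Λ := ⟨hx, mem_window.2 hΛ⟩
      rw [hempty] at hx'
      exact absurd hx' (notMem_empty x)
    · exact ⟨hx, hΛ⟩
  · rintro ⟨hx, hΛ⟩
    exact Or.inr ⟨hx, hΛ⟩

/-- **Gluing is jointly measurable** in the boundary condition and the inner configuration
(restriction is measurable and superposition is jointly measurable on configurations, the tree's
`PointConfig.measurable_union'`). [folklore] -/
theorem measurable_glue_uncurry {Λ : Set Pos} (hΛ : MeasurableSet Λ) :
    Measurable fun q : PointConfig Phase × PointConfig Phase => glue Λ q.1 q.2 := by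
  have hu : Measurable fun c : PointConfig Phase × PointConfig Phase => c.1 ∪ c.2 :=
    PointConfig.measurable_union'
  exact hu.comp (((PointConfig.measurable_restrict (measurableSet_window hΛ)).comp measurable_snd).prodMk
    ((PointConfig.measurable_restrict (measurableSet_window hΛ).compl).comp measurable_fst))

/-! ### The partition function: void probability from below, one from above -/

/-- The intensity of the window: `(z · λ|_Λ ⊗ M_{u,β})(Λ × ℝ³) = z⁺ λ(Λ)`.
[cite: Ruelle1969, §1.2.1 (2.9)–(2.11)] -/
theorem intensity_window (p : Params) (Λ : Set Pos) :
    intensity p Λ (window Λ) = (Real.toNNReal p.z : ℝ≥0∞) * volume Λ := by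
  rw [intensity, Measure.smul_apply, window, Measure.prod_prod, Measure.restrict_apply_self,
    measure_univ, mul_one]
  rfl

/-- The intensity of a bounded window is finite. [folklore] -/
theorem intensity_window_ne_top (p : Params) {Λ : Set Pos} (hΛb : Bornology.IsBounded Λ) :
    intensity p Λ (window Λ) ≠ ∞ := by
  rw [intensity_window]
  exact ENNReal.mul_ne_top ENNReal.coe_ne_top hΛb.measure_lt_top.ne

/-- **Void probability of the reference process**: the Poisson–Maxwell sample in a bounded Borel
region `Λ` is empty with probability `exp(-z⁺ λ(Λ))`. [cite: Kingman1993, §2.1] -/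
theorem poissonLaw_count_window_eq_zero (p : Params) {Λ : Set Pos} (hΛm : MeasurableSet Λ)
    (hΛb : Bornology.IsBounded Λ) :
    poissonLaw (intensity p Λ) {ξ | ξ.count (window Λ) = 0} =
      ENNReal.ofReal (Real.exp (-(intensity p Λ (window Λ)).toReal)) :=
  (isPoissonPointProcess_poissonLaw_intensity p Λ).measure_count_eq_zero (measurableSet_window hΛm)
    (intensity_window_ne_top p hΛb)

/-- The un-normalised mass `Ξ_Λ(η)` of the hard-core event under the glued reference law is the
reference probability of `{ξ | glue Λ η ξ is hard core}`. [folklore] -/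
theorem map_glue_restrict_hardCoreSet_univ (p : Params) {Λ : Set Pos} (hΛm : MeasurableSet Λ)
    (η : PointConfig Phase) :
    (((poissonLaw (intensity p Λ)).map (glue Λ η)).restrict (hardCoreSet p.σ)) univ =
      poissonLaw (intensity p Λ) (glue Λ η ⁻¹' hardCoreSet p.σ) := by
  rw [Measure.restrict_apply MeasurableSet.univ, univ_inter,
    Measure.map_apply (measurable_glue hΛm η) (measurableSet_hardCoreSet _)]

/-- **Positivity of the partition function**: if the boundary condition satisfies the hard core
outside `Λ`, then `Ξ_Λ(η) ≥ exp(-z⁺ λ(Λ)) > 0` — on the void event the glued configuration is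
`η|_{Λᶜ}`, which is hard core ("by considering the empty configuration").
[cite: Richthammer2007, §3.3 (p. 7)] -/
theorem void_le_partition (p : Params) {Λ : Set Pos} (hΛm : MeasurableSet Λ)
    (hΛb : Bornology.IsBounded Λ) {η : PointConfig Phase}
    (hη : IsHardCore p.σ (η.restrict (window Λ)ᶜ)) :
    ENNReal.ofReal (Real.exp (-(intensity p Λ (window Λ)).toReal)) ≤
      (((poissonLaw (intensity p Λ)).map (glue Λ η)).restrict (hardCoreSet p.σ)) univ := by
  rw [map_glue_restrict_hardCoreSet_univ p hΛm, ← poissonLaw_count_window_eq_zero p hΛm hΛb]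
  refine measure_mono fun ξ hξ => ?_
  change IsHardCore p.σ (glue Λ η ξ)
  rw [glue_eq_restrict_of_count_eq_zero hξ]
  exact hη

/-- The partition function is at most one (the reference law is a probability measure).
[folklore] -/
theorem partition_le_one (p : Params) {Λ : Set Pos} (hΛm : MeasurableSet Λ) (η : PointConfig Phase) :
    (((poissonLaw (intensity p Λ)).map (glue Λ η)).restrict (hardCoreSet p.σ)) univ ≤ 1 := by
  haveI := (isPoissonPointProcess_poissonLaw_intensity p Λ).isProbabilityMeasure
  rw [map_glue_restrict_hardCoreSet_univ p hΛm]
  exact prob_le_one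

/-- **The hard-sphere specification is a probability measure** in every bounded Borel region,
for every boundary condition that satisfies the hard core outside the region (Georgii 2011,
Def. 1.23 (i) for this specification; for a boundary condition violating the hard core outside
`Λ` the kernel is the documented junk value `0`). [cite: Georgii2011, Def. 1.23] -/
theorem isProbabilityMeasure_gibbsSpec (p : Params) {Λ : Set Pos} (hΛm : MeasurableSet Λ)
    (hΛb : Bornology.IsBounded Λ) {η : PointConfig Phase}
    (hη : IsHardCore p.σ (η.restrict (window Λ)ᶜ)) : IsProbabilityMeasure (gibbsSpec p Λ η) := by
  have h0 : (((poissonLaw (intensity p Λ)).map (glue Λ η)).restrict (hardCoreSet p.σ)) univ ≠ 0 :=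
    ne_of_gt (lt_of_lt_of_le (ENNReal.ofReal_pos.2 (Real.exp_pos _)) (void_le_partition p hΛm hΛb hη))
  have htop : (((poissonLaw (intensity p Λ)).map (glue Λ η)).restrict (hardCoreSet p.σ)) univ ≠ ∞ :=
    ne_top_of_le_ne_top ENNReal.one_ne_top (partition_le_one p hΛm η)
  refine ⟨?_⟩
  rw [gibbsSpec_def, Measure.smul_apply, smul_eq_mul, ENNReal.inv_mul_cancel h0 htop]

/-- In particular, for a globally hard-core boundary condition (e.g. `η = ∅`, free boundary
condition) the specification is a probability measure in every bounded Borel region. [cite: Georgii2011, Def. 1.23] -/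
theorem isProbabilityMeasure_gibbsSpec_of_isHardCore (p : Params) {Λ : Set Pos}
    (hΛm : MeasurableSet Λ) (hΛb : Bornology.IsBounded Λ) {η : PointConfig Phase}
    (hη : IsHardCore p.σ η) : IsProbabilityMeasure (gibbsSpec p Λ η) :=
  isProbabilityMeasure_gibbsSpec p hΛm hΛb (hη.restrict _)

/-- The free-boundary-condition finite-volume hard-sphere Gibbs distribution `γ_Λ(· | ∅)` is a
probability measure for every bounded Borel `Λ` and all parameters. [cite: Ruelle1969, §1.2.2] -/
theorem isProbabilityMeasure_gibbsSpec_empty (p : Params) {Λ : Set Pos} (hΛm : MeasurableSet Λ)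
    (hΛb : Bornology.IsBounded Λ) : IsProbabilityMeasure (gibbsSpec p Λ ∅) :=
  isProbabilityMeasure_gibbsSpec_of_isHardCore p hΛm hΛb (isHardCore_empty _)

/-- The specification is always a sub-probability measure: total mass `Ξ_Λ(η)⁻¹ Ξ_Λ(η) ≤ 1`
(`= 1` in the regime of `isProbabilityMeasure_gibbsSpec`, `= 0` in the documented junk case).
[folklore] -/
theorem gibbsSpec_univ_le_one (p : Params) (Λ : Set Pos) (η : PointConfig Phase) :
    gibbsSpec p Λ η univ ≤ 1 := by
  rw [gibbsSpec_def, Measure.smul_apply, smul_eq_mul]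
  exact ENNReal.inv_mul_le_one _

/-- Hence the specification is a finite measure for all regions and boundary conditions.
[folklore] -/
theorem isFiniteMeasure_gibbsSpec (p : Params) (Λ : Set Pos) (η : PointConfig Phase) :
    IsFiniteMeasure (gibbsSpec p Λ η) :=
  ⟨lt_of_le_of_lt (gibbsSpec_univ_le_one p Λ η) ENNReal.one_lt_top⟩

/-! ### Properness: outside `Λ` the specification reproduces the boundary condition -/

/-- Outside the window of `Λ` a glued configuration IS the boundary condition. [folklore] -/
theorem restrict_compl_glue (Λ : Set Pos) (η ξ : PointConfig Phase) :
    (glue Λ η ξ).restrict (window Λ)ᶜ = η.restrict (window Λ)ᶜ := by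
  ext x
  change x ∈ (glue Λ η ξ).carrier ∩ (window Λ)ᶜ ↔ x ∈ η.carrier ∩ (window Λ)ᶜ
  simp only [mem_inter_iff, mem_compl_iff, mem_window, PointConfig.mem_carrier, mem_glue_iff]
  tauto

/-- **Properness of the specification** (Georgii 2011, Def. 1.23 (ii): `γ_Λ(· | ω)` is
concentrated on configurations that coincide with `ω` off `Λ`): the law of the configuration
outside `Λ` under `γ_Λ(· | η)` is the point mass at `η|_{Λᶜ}` (times the total mass, `1` in the
proper regime, `0` in the junk case). [cite: Georgii2011, Def. 1.23] -/
theorem gibbsSpec_map_restrict_compl (p : Params) {Λ : Set Pos} (hΛm : MeasurableSet Λ)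
    (η : PointConfig Phase) :
    (gibbsSpec p Λ η).map (PointConfig.restrict (window Λ)ᶜ) =
      gibbsSpec p Λ η univ • Measure.dirac (η.restrict (window Λ)ᶜ) := by
  have hR : Measurable (PointConfig.restrict (window Λ)ᶜ : PointConfig Phase → PointConfig Phase) :=
    PointConfig.measurable_restrict (measurableSet_window hΛm).compl
  have hH := measurableSet_hardCoreSet p.σ
  ext B hB
  rw [Measure.map_apply hR hB, Measure.smul_apply, smul_eq_mul, Measure.dirac_apply' _ hB]
  by_cases hη : η.restrict (window Λ)ᶜ ∈ B
  · rw [indicator_of_mem hη, Pi.one_apply, mul_one, gibbsSpec_def, Measure.smul_apply,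
      Measure.smul_apply, smul_eq_mul, smul_eq_mul, Measure.restrict_apply (hR hB),
      Measure.restrict_apply MeasurableSet.univ, univ_inter,
      Measure.map_apply (measurable_glue hΛm η) ((hR hB).inter hH),
      Measure.map_apply (measurable_glue hΛm η) hH]
    congr 2
    ext ξ
    constructor
    · exact fun h => h.2
    · intro h
      refine ⟨?_, h⟩
      change (glue Λ η ξ).restrict (window Λ)ᶜ ∈ B
      rwa [restrict_compl_glue]
  · rw [indicator_of_notMem hη, mul_zero, gibbsSpec_def, Measure.smul_apply, smul_eq_mul,
      Measure.restrict_apply (hR hB), Measure.map_apply (measurable_glue hΛm η) ((hR hB).inter hH)]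
    have hempty : glue Λ η ⁻¹' (PointConfig.restrict (window Λ)ᶜ ⁻¹' B ∩ hardCoreSet p.σ) = ∅ :=
      eq_empty_of_forall_notMem fun ξ h => hη (by
        have h1 : (glue Λ η ξ).restrict (window Λ)ᶜ ∈ B := h.1
        rwa [restrict_compl_glue] at h1)
    rw [hempty, measure_empty, mul_zero]

/-- In the proper regime: under `γ_Λ(· | η)` the configuration outside `Λ` equals `η|_{Λᶜ}`
almost surely, in law. [cite: Georgii2011, Def. 1.23] -/
theorem gibbsSpec_map_restrict_compl_of_isHardCore (p : Params) {Λ : Set Pos}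
    (hΛm : MeasurableSet Λ) (hΛb : Bornology.IsBounded Λ) {η : PointConfig Phase}
    (hη : IsHardCore p.σ (η.restrict (window Λ)ᶜ)) :
    (gibbsSpec p Λ η).map (PointConfig.restrict (window Λ)ᶜ) =
      Measure.dirac (η.restrict (window Λ)ᶜ) := by
  haveI := isProbabilityMeasure_gibbsSpec p hΛm hΛb hη
  rw [gibbsSpec_map_restrict_compl p hΛm, measure_univ, one_smul]

/-! ### Measurability in the boundary condition -/

/-- The glued reference law of an event depends measurably on the boundary condition
(measurability part of Fubini for the jointly measurable gluing). [folklore] -/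
theorem measurable_map_glue_apply (p : Params) {Λ : Set Pos} (hΛ : MeasurableSet Λ)
    {B : Set (PointConfig Phase)} (hB : MeasurableSet B) :
    Measurable fun η => (poissonLaw (intensity p Λ)).map (glue Λ η) B := by
  haveI := (isPoissonPointProcess_poissonLaw_intensity p Λ).isProbabilityMeasure
  have hS : MeasurableSet {q : PointConfig Phase × PointConfig Phase | glue Λ q.1 q.2 ∈ B} :=
    hB.preimage (measurable_glue_uncurry hΛ)
  have h := measurable_measure_prodMk_left (ν := poissonLaw (intensity p Λ)) hS
  have heq : (fun η => (poissonLaw (intensity p Λ)).map (glue Λ η) B) = fun η =>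
      poissonLaw (intensity p Λ)
        (Prod.mk η ⁻¹' {q : PointConfig Phase × PointConfig Phase | glue Λ q.1 q.2 ∈ B}) := by
    funext η
    rw [Measure.map_apply (measurable_glue hΛ η) hB]
    rfl
  rw [heq]
  exact h

/-- **The hard-sphere specification is a measurable kernel in the boundary condition**:
`η ↦ γ_Λ(A | η)` is measurable for measurable `Λ` and `A` (Georgii 2011, Def. 1.23 (ii);
Richthammer 2007, §3.3: "`γ_Λ` is a probability kernel"). [cite: Georgii2011, Def. 1.23] -/
theorem measurable_gibbsSpec_apply (p : Params) {Λ : Set Pos} (hΛ : MeasurableSet Λ)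
    {A : Set (PointConfig Phase)} (hA : MeasurableSet A) :
    Measurable fun η => gibbsSpec p Λ η A := by
  have hH := measurableSet_hardCoreSet p.σ
  have h1 : ∀ η, gibbsSpec p Λ η A =
      ((poissonLaw (intensity p Λ)).map (glue Λ η) (hardCoreSet p.σ))⁻¹ *
        (poissonLaw (intensity p Λ)).map (glue Λ η) (A ∩ hardCoreSet p.σ) := fun η => by
    rw [gibbsSpec_def, Measure.smul_apply, smul_eq_mul, Measure.restrict_apply MeasurableSet.univ,
      univ_inter, Measure.restrict_apply hA]
  simp_rw [h1]
  exact (measurable_map_glue_apply p hΛ hH).inv.mul (measurable_map_glue_apply p hΛ (hA.inter hH))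

/-- The DLR integrand of a Gibbs state is a.e.-measurable (so that the lower Lebesgue integrals in
`IsGibbs` are honest integrals). [folklore] -/
theorem aemeasurable_gibbsSpec_apply (p : Params) {Λ : Set Pos} (hΛ : MeasurableSet Λ)
    {A : Set (PointConfig Phase)} (hA : MeasurableSet A) (μ : Measure (PointConfig Phase)) :
    AEMeasurable (fun η => gibbsSpec p Λ η A) μ :=
  (measurable_gibbsSpec_apply p hΛ hA).aemeasurable

/-! ### DLR states are supported on hard-core configurations -/

/-- **A DLR hard-sphere state gives measure zero to the non-hard-core configurations**: the DLR
equation in the empty region reads `μ(A) = ∫ γ_∅(A | η) dμ(η)`, and every `γ_Λ(· | η)` vanishes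
off the hard-core event (Richthammer 2007, (3.2)). [cite: Richthammer2007, §3.3 (3.2)] -/
theorem IsGibbs.measure_compl_hardCoreSet {p : Params} {μ : Measure (PointConfig Phase)}
    (h : IsGibbs p μ) : μ (hardCoreSet p.σ)ᶜ = 0 := by
  rw [← h.2 ∅ MeasurableSet.empty Bornology.isBounded_empty _ (measurableSet_hardCoreSet _).compl]
  simp [gibbsSpec_apply_compl_hardCoreSet]

/-- **Almost every configuration of a DLR hard-sphere state is a hard-sphere configuration.**
[cite: Richthammer2007, §3.3 (3.2)] -/
theorem IsGibbs.ae_isHardCore {p : Params} {μ : Measure (PointConfig Phase)} (h : IsGibbs p μ) :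
    ∀ᵐ c ∂μ, IsHardCore p.σ c := by
  rw [ae_iff]
  exact h.measure_compl_hardCoreSet

/-- Hence a DLR state gives full mass to the hard-core event. [cite: Richthammer2007, §3.3 (3.2)] -/
theorem IsGibbs.measure_hardCoreSet {p : Params} {μ : Measure (PointConfig Phase)} (h : IsGibbs p μ) :
    μ (hardCoreSet p.σ) = 1 := by
  haveI := h.isProbabilityMeasure
  rw [← prob_compl_eq_zero_iff (measurableSet_hardCoreSet _)]
  exact h.measure_compl_hardCoreSet

/-- Under a DLR state, almost every boundary condition makes `γ_Λ(· | η)` a probability measure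
(bounded Borel `Λ`): the properness hypothesis of `isProbabilityMeasure_gibbsSpec` holds a.s. by
`IsGibbs.ae_isHardCore`. [cite: Georgii2011, Def. 1.23] -/
theorem IsGibbs.ae_isProbabilityMeasure_gibbsSpec {p : Params} {μ : Measure (PointConfig Phase)}
    (h : IsGibbs p μ) {Λ : Set Pos} (hΛm : MeasurableSet Λ) (hΛb : Bornology.IsBounded Λ) :
    ∀ᵐ η ∂μ, IsProbabilityMeasure (gibbsSpec p Λ η) :=
  h.ae_isHardCore.mono fun _ hη => isProbabilityMeasure_gibbsSpec p hΛm hΛb (hη.restrict _)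

/-- Consequently the DLR integrand is everywhere at most one: `γ_Λ(A | η) ≤ 1`. [folklore] -/
theorem gibbsSpec_apply_le_one (p : Params) (Λ : Set Pos) (η : PointConfig Phase)
    (A : Set (PointConfig Phase)) : gibbsSpec p Λ η A ≤ 1 :=
  (measure_mono (subset_univ A)).trans (gibbsSpec_univ_le_one p Λ η)

/-! ### The cubes `Λ_L = [-L, L]³` of the specific relative entropy -/

/-- `Λ_L` is the preimage of the order interval `[-L, L]` of `Fin 3 → ℝ`. [folklore] -/
theorem cube_eq_preimage (L : ℝ) :
    cube L = (WithLp.ofLp : Pos → Fin 3 → ℝ) ⁻¹' Icc (fun _ => -L) (fun _ => L) := by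
  ext x
  simp only [mem_preimage, mem_Icc, Pi.le_def, ← forall_and]
  rfl

/-- The cubes are Borel sets. [folklore] -/
theorem measurableSet_cube (L : ℝ) : MeasurableSet (cube L) := by
  rw [cube_eq_preimage]
  exact measurableSet_Icc.preimage (PiLp.continuous_ofLp 2 _).measurable

/-- Points of `Λ_L` have norm at most `3|L|`. [folklore] -/
theorem norm_le_of_mem_cube {L : ℝ} {x : Pos} (hx : x ∈ cube L) : ‖x‖ ≤ 3 * |L| := by
  have hcoord : ∀ i, ‖x i‖ ^ 2 ≤ L ^ 2 := fun i => by
    have h1 := (hx i).1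
    have h2 := (hx i).2
    rw [Real.norm_eq_abs, sq_abs]
    nlinarith
  have hsum : ∑ i, ‖x i‖ ^ 2 ≤ (3 * |L|) ^ 2 := by
    calc ∑ i, ‖x i‖ ^ 2 ≤ ∑ _i : Fin 3, L ^ 2 := Finset.sum_le_sum fun i _ => hcoord i
      _ = 3 * L ^ 2 := by simp
      _ ≤ (3 * |L|) ^ 2 := by rw [mul_pow, sq_abs]; nlinarith [sq_nonneg L]
  rw [EuclideanSpace.norm_eq]
  calc Real.sqrt (∑ i, ‖x i‖ ^ 2) ≤ Real.sqrt ((3 * |L|) ^ 2) := Real.sqrt_le_sqrt hsum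
    _ = 3 * |L| := Real.sqrt_sq (by positivity)

/-- The cubes are bounded. [folklore] -/
theorem isBounded_cube (L : ℝ) : Bornology.IsBounded (cube L) :=
  isBounded_iff_forall_norm_le.2 ⟨3 * |L|, fun _ hx => norm_le_of_mem_cube hx⟩

/-- **`λ(Λ_L) = (2L)³`** (both sides vanish for `L < 0`). [folklore] -/
theorem volume_cube (L : ℝ) : volume (cube L) = ENNReal.ofReal (2 * L) ^ 3 := by
  rw [cube_eq_preimage, (PiLp.volume_preserving_ofLp (Fin 3)).measure_preimage
    measurableSet_Icc.nullMeasurableSet, Real.volume_Icc_pi]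
  simp only [sub_neg_eq_add, Finset.prod_const, Finset.card_univ, Fintype.card_fin]
  rw [← two_mul]

/-- The volume of a cube is finite and, for `L > 0`, nonzero — so the normalisation
`|Λ_L|⁻¹` in `specificRelEntropy` is neither `0` nor `∞` along the cubes `Λ_{n+1}`. [folklore] -/
theorem volume_cube_ne_zero_and_ne_top {L : ℝ} (hL : 0 < L) :
    volume (cube L) ≠ 0 ∧ volume (cube L) ≠ ∞ := by
  rw [volume_cube L]
  exact ⟨pow_ne_zero _ ((ENNReal.ofReal_pos.2 (by linarith)).ne'),
    ENNReal.pow_ne_top ENNReal.ofReal_ne_top⟩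

/-- The DLR equation of a Gibbs state in the cubes `Λ_L`. [cite: Georgii2011, Def. 1.23] -/
theorem IsGibbs.lintegral_gibbsSpec_cube {p : Params} {μ : Measure (PointConfig Phase)}
    (h : IsGibbs p μ) (L : ℝ) {A : Set (PointConfig Phase)} (hA : MeasurableSet A) :
    ∫⁻ η, gibbsSpec p (cube L) η A ∂μ = μ A :=
  h.2 (cube L) (measurableSet_cube L) (isBounded_cube L) A hA

/-- The free-boundary-condition hard-sphere Gibbs distribution in every cube is a probability
measure (the reference measures of the Fritz–Funaki–Lebowitz form of the specific relative
entropy). [cite: Ruelle1969, §1.2.2] -/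
theorem isProbabilityMeasure_gibbsSpec_cube_empty (p : Params) (L : ℝ) :
    IsProbabilityMeasure (gibbsSpec p (cube L) ∅) :=
  isProbabilityMeasure_gibbsSpec_empty p (measurableSet_cube L) (isBounded_cube L)

end Literature.MathematicalPhysics.StatisticalMechanics.HardSphere

end
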